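import Literature.NumberTheory.Transcendental.CurvePeriodsEllipticGridProofs
import Literature.NumberTheory.Transcendental.CurvePeriodsEllipticDoublingProofs
import Literature.NumberTheory.Transcendental.CurvePeriodsPuncturedLineProofs
import Literature.NumberTheory.Transcendental.AnalyticSubgroupElliptic
import HarnessLib

/-!
# Periods of curve type on an elliptic curve, VI: closed paths, from the analytic subgroup theorem

Companion of `Literature/NumberTheory/Transcendental/CurvePeriods.lean` (Huber–Wüstholz 2022,
Thm. 13.3 (2) = Kontsevich's period conjecture for periods of curve type, rendered on explicit
period symbols `(Z, ω, γ)` with the elementary relations (R1)–(R5); the general statement is the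
named fact `HuberWustholzCurvePeriods`) and the endgame of the genus-one files
`CurvePeriodsElliptic{Forms,Segments,Doubling,Lift,Polygon,Grid}Proofs.lean`: for a period pair
`L` with algebraic invariants `g₂, g₃` and WITHOUT complex multiplication, the sub-diagram

  `{E_L with CLOSED paths} ∪ {𝔾ₘ, 𝔸¹, punctured lines Z_a}`  (`E_L : y² = x³ − (g₂/4)x − g₃/4`)

of the theorem is proved from ONE existing named fact of the tree taken as a hypothesis,
`Literature.NumberTheory.Transcendental.analyticSubgroupTheorem_GaGmE_periods` (Wüstholz's
analytic subgroup theorem for `𝔾ₐ × 𝔾ₘ^ι × (E♮)^κ` at period vectors,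
`AnalyticSubgroupElliptic.lean`; itself reduced in the tree to Philippon's zero estimate
`philippon1986_std`), exactly as the seven-period statement `HuberWustholzOnePeriods` is
(`HuberWustholzOnePeriods_of_analyticSubgroupTheorem_periods`). Nothing is asserted; no new
`Prop` is introduced.

* `Ell.span_descent_theta0_iter`, `Ell.span_descent_theta1_iter` — the `i`-fold doubling descent
  `(E_L, θ, φ∘[2ⁱa, 2ⁱb]) ∼ 2ⁱ (E_L, θ, φ∘[a, b]) (+ C·𝟙 for θ₁)` (iterating
  `Ell.span_descent_theta0/1`, functoriality (R4) along the doubling map);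
* `Ell.two_pow_mul_step_notMem`, `Ell.two_pow_mul_vtx_sub_mem`, `Ell.segPath_two_pow_step` —
  the scaled unit steps of the torsion grid `G_k = g₀ + 2⁻ᵏΛ` (`g₀ = (ω₁ + ω₂)/3`) never meet `Λ`
  (`3 ∤ 2ⁱ⁺ᵏ`), and after `2k` doublings a unit step of `G_{2k}` IS a basic loop
  `φ∘[g₀, g₀ + ω_j]` (`4ᵏ ≡ 1 (mod 3)` and `Λ`-periodicity of `φ`);
* `Ell.span_stepSym_theta0`, `Ell.span_stepSym_theta1` — hence every unit step of `G_{2k}` is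
  `4⁻ᵏ` times a basic loop modulo the relations (plus an algebraic multiple of `𝟙` for `θ₁`);
* `Ell.period_stepSym_theta0_zero`, `Ell.period_stepSym_theta1_zero` — the basic loops have the
  periods `2ω_j` and `−2η_j` (book §18.1);
* `Ell.exists_loop_normalForm` — **normal form of a closed-path symbol**: for every closed `C¹`
  path `γ` on `E_L` and every form `ω` over `ℚ̄`,
  `(E_L, ω, γ) ∼ Σ_j A_j (E_L, θ₀, φ∘[g₀, g₀+ω_j]) + Σ_j B_j (E_L, θ₁, φ∘[g₀, g₀+ω_j]) + e·𝟙`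
  with `A_j, B_j, e ∈ ℚ̄` (`Weier.exists_rel_symbol` + `Ell.exists_stepComb_of_closed` + the
  descent of the steps), so that its period is `2(A₀ω₁ + A₁ω₂) − 2(B₀η₁ + B₁η₂) + e`;
* `huberWustholzCurvePeriods_of_ellipticLoops` — **the theorem** for combinations supported on
  closed-path symbols of `E_L`, on `𝔾ₘ` and on `𝔸¹`: modulo relations the combination is
  `loopPart A B + Σ_i D_i ℓ(m_i) + e·𝟙` with a `ℚ`-basis `(m_i)` of the logarithms involved
  (`exists_logSym_rel`, `span_logSym_sum` of `CurvePeriodsGmBakerProofs.lean`); its period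
  `2(A₀ω₁ + A₁ω₂) − 2(B₀η₁ + B₁η₂) + Σ D_i m_i + e` vanishes, and the analytic subgroup theorem at
  `u = (1; (m_i)_i; (ω₁, η₁), (ω₂, η₂))` — whose degenerate alternatives are excluded by `1 ≠ 0`,
  the `ℚ`-independence of the `m_i` and the `ℝ`-independence of `ω₁, ω₂`
  (`PeriodPair.not_int_rel_periods`) — forces `A = B = 0`, `D = 0`, `e = 0`;
* `huberWustholzCurvePeriods_of_ellipticLoops'` — the same from the general fact
  `analyticSubgroupTheorem_GaGmE`;
* `huberWustholzCurvePeriods_of_puncturedLine_or_ellipticLoops` — adding all punctured lines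
  `Z_a = {y ∏ᵢ (x − aᵢ) = 1}` (arbitrary paths) through `exists_transfer_puncturedLine` and
  `span_of_transfer_finsupp` (`CurvePeriodsPuncturedLineProofs.lean`).

What is NOT here: open paths on `E_L` (incomplete elliptic integrals `u`, `ζ(u)` at algebraic
points: these need the analytic subgroup theorem at arbitrary algebraic points of `E♮`, the fact
`analyticSubgroupTheorem_GaGmE`, together with a normal form for open paths), `E_L` minus further
points (integrals of the third kind: extensions of `E` by `𝔾ₘ`), CM curves (where
`End(E) ⊋ ℤ` contributes the relations `ω₂ = τω₁`, …; book §15.2), several curves, and curves of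
genus `≥ 2` — i.e. the general fact `HuberWustholzCurvePeriods`, whose printed proof needs the
analytic subgroup theorem for arbitrary commutative algebraic groups and the theory of 1-motives.

## References

* A. Huber, G. Wüstholz, *Transcendence and Linear Relations of 1-Periods*, Cambridge Tracts in
  Mathematics 227, CUP 2022 [HuberWustholz2022]: Thm. 13.3 (2) (p. 121 of the held text), §13.2
  and Thm. 13.9 (pp. 122–125), §13.1 (B) (p. 120, functoriality), §3.3.1 (pp. 42–44), Thm. 15.3 (1)
  and Ch. 15 (dimension computations for `[ℤ → 𝔾ₘ] × h¹(E)`), §18.1 (p. 160: `ωᵢ = ∫ ω`,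
  `ηᵢ = ∫ η`, `exp_E^* ω = dz`, `exp_E^* η = −dζ`), Thm. 6.2 (analytic subgroup theorem).
* G. Wüstholz, *Algebraische Punkte auf analytischen Untergruppen algebraischer Gruppen*,
  Ann. of Math. 129 (1989), 501–517 (the analytic subgroup theorem; here only through the named
  fact `analyticSubgroupTheorem_GaGmE_periods`).
-/

noncomputable section

open scoped BigOperators
open MvPolynomial Set Complex

namespace Literature.NumberTheory.Transcendental

namespace CurvePeriods

set_option quotPrecheck false in
/-- Membership in the `ℚ̄`-span of the elementary relations, in the format of the conclusion of
`HuberWustholzCurvePeriods`. -/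
local notation "InSpan" c:max => ∃ (k : ℕ) (ρ : Fin k → (PeriodSymbol →₀ ℂ)) (a : Fin k → ℂ),
  (∀ l, IsElementaryRelation (ρ l)) ∧ (∀ l, IsAlgebraic ℚ (a l)) ∧ c = ∑ l, a l • ρ l

namespace Ell

variable (L : PeriodPair)

/-! ### Scaling segments and grid points by powers of two -/

/-- `2 · (2ⁱ a + t (2ⁱ b − 2ⁱ a)) = 2ⁱ⁺¹ (a + t (b − a))`. [folklore] -/
theorem two_mul_two_pow_seg (i : ℕ) (a b : ℂ) (t : ℝ) :
    2 * (2 ^ i * a + (t : ℂ) * (2 ^ i * b - 2 ^ i * a)) = 2 ^ (i + 1) * (a + t * (b - a)) := by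
  ring

/-- `2ⁱ a + t (2ⁱ b − 2ⁱ a) = 2ⁱ (a + t (b − a))`. [folklore] -/
theorem two_pow_seg (i : ℕ) (a b : ℂ) (t : ℝ) :
    2 ^ i * a + (t : ℂ) * (2 ^ i * b - 2 ^ i * a) = 2 ^ i * (a + t * (b - a)) := by
  ring

/-- **Scaled grid coordinates are never integers**: `2ⁱ (1/3 + m/2ᵏ) ∉ ℤ` (as `3 ∤ 2ⁱ⁺ᵏ`).
[folklore] -/
theorem two_pow_mul_gc_ne_int (i k : ℕ) (m n : ℤ) : 2 ^ i * gc k m ≠ n := by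
  intro h
  have e : (2 : ℝ) ^ i * gc k m * (3 * 2 ^ k) = 2 ^ i * 2 ^ k + 3 * 2 ^ i * m := by
    unfold gc
    field_simp
  rw [h] at e
  have hint : (n * (3 * 2 ^ k) : ℤ) = 2 ^ i * 2 ^ k + 3 * 2 ^ i * m := by exact_mod_cast e
  exact not_three_dvd_two_pow (i + k) ⟨n * 2 ^ k - 2 ^ i * m, by rw [pow_add]; linear_combination -hint⟩

/-- **Scaled unit steps avoid `Λ`**: for every `i`, the set `2ⁱ · [vtx k μ, vtx k (nbr μ j)]` does not
meet `Λ` (its constant lattice coordinate is `2ⁱ(1/3 + ·/2ᵏ) ∉ ℤ`). [folklore] -/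
theorem two_pow_mul_step_notMem (i k : ℕ) (μ : ℤ × ℤ) (j : Fin 2) :
    ∀ t ∈ Icc (0 : ℝ) 1,
      2 ^ i * (vtx L k μ + t * (vtx L k (nbr μ j) - vtx L k μ)) ∉ L.lattice := by
  intro t _
  have h0 : (2 : ℂ) ^ i * (vtx L k μ + (t : ℂ) * (vtx L k (nbr μ 0) - vtx L k μ)) ∉ L.lattice := by
    have e : (2 : ℂ) ^ i * (vtx L k μ + (t : ℂ) * (vtx L k (nbr μ 0) - vtx L k μ)) =
        ((2 ^ i * (gc k μ.1 + t * (gc k (μ.1 + 1) - gc k μ.1)) : ℝ) : ℂ) * L.ω₁ +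
          ((2 ^ i * gc k μ.2 : ℝ) : ℂ) * L.ω₂ := by
      simp only [vtx, nbr_zero]
      push_cast
      ring
    rw [e]
    exact notMem_lattice_of_snd_notInt fun q => two_pow_mul_gc_ne_int i k μ.2 q
  have h1 : (2 : ℂ) ^ i * (vtx L k μ + (t : ℂ) * (vtx L k (nbr μ 1) - vtx L k μ)) ∉ L.lattice := by
    have e : (2 : ℂ) ^ i * (vtx L k μ + (t : ℂ) * (vtx L k (nbr μ 1) - vtx L k μ)) =
        ((2 ^ i * gc k μ.1 : ℝ) : ℂ) * L.ω₁ +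
          ((2 ^ i * (gc k μ.2 + t * (gc k (μ.2 + 1) - gc k μ.2)) : ℝ) : ℂ) * L.ω₂ := by
      simp only [vtx, nbr_one]
      push_cast
      ring
    rw [e]
    exact notMem_lattice_of_fst_notInt fun q => two_pow_mul_gc_ne_int i k μ.1 q
  fin_cases j
  exacts [h0, h1]

/-- **`2ⁱ a` is an algebraic point if `a` is** and all `2ⁱ' a` stay off the lattice (iterated
doubling over `ℚ̄`, `IsAlgPt.two_mul`). [folklore] -/
theorem IsAlgPt.two_pow_mul (h₂ : IsAlgebraic ℚ L.g₂) {a : ℂ} (ha : IsAlgPt L a)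
    (h : ∀ i : ℕ, 2 ^ i * a ∉ L.lattice) (i : ℕ) : IsAlgPt L (2 ^ i * a) := by
  induction i with
  | zero => simpa using ha
  | succ i ih =>
    have e : (2 : ℂ) ^ (i + 1) * a = 2 * (2 ^ i * a) := by ring
    rw [e]
    exact IsAlgPt.two_mul L h₂ ih (by rw [← e]; exact h (i + 1))

/-! ### Iterated doubling descent on segments -/

section Descent

variable (h₂ : IsAlgebraic ℚ L.g₂) (h₃ : IsAlgebraic ℚ L.g₃)
include h₂ h₃

/-- **Iterated doubling descent for `θ₀`**: if all the scaled segments `2ⁱ'·[a, b]` avoid `Λ`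
(algebraic end points), then `(E_L, θ₀, φ∘[2ⁱa, 2ⁱb]) − 2ⁱ · (E_L, θ₀, φ∘[a, b])` lies in the span
of the elementary relations (`i` applications of `span_descent_theta0`, i.e. of functoriality
(R4) along the doubling map). [cite: HuberWustholz2022, §13.1 (B) (p. 120), §18.1 (p. 160)] -/
theorem span_descent_theta0_iter (i : ℕ) :
    ∀ {a b : ℂ} (_hall : ∀ i' : ℕ, ∀ t ∈ Icc (0 : ℝ) 1, 2 ^ i' * (a + t * (b - a)) ∉ L.lattice)
      (ha : IsAlgPt L a) (hb : IsAlgPt L b)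
      (hab : ∀ t ∈ Icc (0 : ℝ) 1, a + t * (b - a) ∉ L.lattice)
      (hAB : ∀ t ∈ Icc (0 : ℝ) 1, 2 ^ i * a + t * (2 ^ i * b - 2 ^ i * a) ∉ L.lattice)
      (hA : IsAlgPt L (2 ^ i * a)) (hB : IsAlgPt L (2 ^ i * b)),
      InSpan (Finsupp.single (⟨curve L, smooth L h₂ h₃, theta0 L, hasAlgCoeffs_theta0 L h₂ h₃,
          segPath hAB hA hB⟩ : PeriodSymbol) (1 : ℂ) -
        ((2 : ℂ) ^ i) • Finsupp.single (⟨curve L, smooth L h₂ h₃, theta0 L,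
          hasAlgCoeffs_theta0 L h₂ h₃, segPath hab ha hb⟩ : PeriodSymbol) 1) := by
  induction i with
  | zero =>
    intro a b _ ha hb hab hAB hA hB
    have e : segPath hAB hA hB = segPath hab ha hb :=
      segPath_congr L (by simp) (by simp) _ _ _ _ _ _
    rw [e, pow_zero, one_smul, sub_self]
    exact span_zero
  | succ i ih =>
    intro a b hall ha hb hab hAB hA hB
    have hI0 : (0 : ℝ) ∈ Icc (0 : ℝ) 1 := ⟨le_rfl, zero_le_one⟩
    have hI1 : (1 : ℝ) ∈ Icc (0 : ℝ) 1 := ⟨zero_le_one, le_rfl⟩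
    have ha_all : ∀ i' : ℕ, 2 ^ i' * a ∉ L.lattice := fun i' => by
      simpa using hall i' 0 hI0
    have hb_all : ∀ i' : ℕ, 2 ^ i' * b ∉ L.lattice := fun i' => by
      simpa using hall i' 1 hI1
    -- the segment at stage `i`
    have hABi : ∀ t ∈ Icc (0 : ℝ) 1, 2 ^ i * a + t * (2 ^ i * b - 2 ^ i * a) ∉ L.lattice :=
      fun t ht => by rw [two_pow_seg]; exact hall i t ht
    have hAi : IsAlgPt L (2 ^ i * a) := IsAlgPt.two_pow_mul L h₂ ha ha_all i
    have hBi : IsAlgPt L (2 ^ i * b) := IsAlgPt.two_pow_mul L h₂ hb hb_all i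
    have hab2 : ∀ t ∈ Icc (0 : ℝ) 1, 2 * (2 ^ i * a + t * (2 ^ i * b - 2 ^ i * a)) ∉ L.lattice :=
      fun t ht => by rw [two_mul_two_pow_seg]; exact hall (i + 1) t ht
    have h2ab := seg_double_notMem L hab2
    have ha2 : IsAlgPt L (2 * (2 ^ i * a)) :=
      IsAlgPt.two_mul L h₂ hAi (by
        have h := ha_all (i + 1)
        rwa [pow_succ', mul_assoc] at h)
    have hb2 : IsAlgPt L (2 * (2 ^ i * b)) :=
      IsAlgPt.two_mul L h₂ hBi (by
        have h := hb_all (i + 1)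
        rwa [pow_succ', mul_assoc] at h)
    have hdesc := span_descent_theta0 L h₂ h₃ hABi hab2 hAi hBi h2ab ha2 hb2
    have hih := ih hall ha hb hab hABi hAi hBi
    have e : segPath hAB hA hB = segPath h2ab ha2 hb2 :=
      segPath_congr L (by ring) (by ring) _ _ _ _ _ _
    obtain ⟨K, ρ, cf, hρ, hcf, hsum⟩ := span_add hdesc (span_smul isAlgebraic_two hih)
    refine ⟨K, ρ, cf, hρ, hcf, ?_⟩
    rw [← hsum, e, pow_succ', ← smul_smul, smul_sub]
    abel

/-- **Iterated doubling descent for `θ₁ = x dx/y`**: under the same hypotheses,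
`(E_L, θ₁, φ∘[2ⁱa, 2ⁱb]) − 2ⁱ · (E_L, θ₁, φ∘[a, b]) − C · 𝟙` lies in the span for some `C ∈ ℚ̄`
(the accumulated constants of `span_descent_theta1`). [cite: HuberWustholz2022, §13.1 (B) (p. 120), §18.1 (p. 160)] -/
theorem span_descent_theta1_iter (i : ℕ) :
    ∀ {a b : ℂ} (_hall : ∀ i' : ℕ, ∀ t ∈ Icc (0 : ℝ) 1, 2 ^ i' * (a + t * (b - a)) ∉ L.lattice)
      (ha : IsAlgPt L a) (hb : IsAlgPt L b)
      (hab : ∀ t ∈ Icc (0 : ℝ) 1, a + t * (b - a) ∉ L.lattice)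
      (hAB : ∀ t ∈ Icc (0 : ℝ) 1, 2 ^ i * a + t * (2 ^ i * b - 2 ^ i * a) ∉ L.lattice)
      (hA : IsAlgPt L (2 ^ i * a)) (hB : IsAlgPt L (2 ^ i * b)),
      ∃ C : ℂ, IsAlgebraic ℚ C ∧
      InSpan (Finsupp.single (⟨curve L, smooth L h₂ h₃, theta1 L, hasAlgCoeffs_theta1 L h₂ h₃,
          segPath hAB hA hB⟩ : PeriodSymbol) (1 : ℂ) -
        ((2 : ℂ) ^ i) • Finsupp.single (⟨curve L, smooth L h₂ h₃, theta1 L,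
          hasAlgCoeffs_theta1 L h₂ h₃, segPath hab ha hb⟩ : PeriodSymbol) 1 -
        C • Finsupp.single PeriodSymbol.unit (1 : ℂ)) := by
  induction i with
  | zero =>
    intro a b _ ha hb hab hAB hA hB
    have e : segPath hAB hA hB = segPath hab ha hb :=
      segPath_congr L (by simp) (by simp) _ _ _ _ _ _
    refine ⟨0, isAlgebraic_zero, ?_⟩
    rw [e, pow_zero, one_smul, sub_self, zero_smul, sub_zero]
    exact span_zero
  | succ i ih =>
    intro a b hall ha hb hab hAB hA hB
    have hI0 : (0 : ℝ) ∈ Icc (0 : ℝ) 1 := ⟨le_rfl, zero_le_one⟩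
    have hI1 : (1 : ℝ) ∈ Icc (0 : ℝ) 1 := ⟨zero_le_one, le_rfl⟩
    have ha_all : ∀ i' : ℕ, 2 ^ i' * a ∉ L.lattice := fun i' => by
      simpa using hall i' 0 hI0
    have hb_all : ∀ i' : ℕ, 2 ^ i' * b ∉ L.lattice := fun i' => by
      simpa using hall i' 1 hI1
    have hABi : ∀ t ∈ Icc (0 : ℝ) 1, 2 ^ i * a + t * (2 ^ i * b - 2 ^ i * a) ∉ L.lattice :=
      fun t ht => by rw [two_pow_seg]; exact hall i t ht
    have hAi : IsAlgPt L (2 ^ i * a) := IsAlgPt.two_pow_mul L h₂ ha ha_all i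
    have hBi : IsAlgPt L (2 ^ i * b) := IsAlgPt.two_pow_mul L h₂ hb hb_all i
    have hab2 : ∀ t ∈ Icc (0 : ℝ) 1, 2 * (2 ^ i * a + t * (2 ^ i * b - 2 ^ i * a)) ∉ L.lattice :=
      fun t ht => by rw [two_mul_two_pow_seg]; exact hall (i + 1) t ht
    have h2ab := seg_double_notMem L hab2
    have ha2 : IsAlgPt L (2 * (2 ^ i * a)) :=
      IsAlgPt.two_mul L h₂ hAi (by
        have h := ha_all (i + 1)
        rwa [pow_succ', mul_assoc] at h)
    have hb2 : IsAlgPt L (2 * (2 ^ i * b)) :=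
      IsAlgPt.two_mul L h₂ hBi (by
        have h := hb_all (i + 1)
        rwa [pow_succ', mul_assoc] at h)
    have hdesc := span_descent_theta1 L h₂ h₃ hABi hab2 hAi hBi h2ab ha2 hb2
    have hc := isAlgebraic_descent_const L h₂ hAi hBi
    obtain ⟨C, hC, hih⟩ := ih hall ha hb hab hABi hAi hBi
    have e : segPath hAB hA hB = segPath h2ab ha2 hb2 :=
      segPath_congr L (by ring) (by ring) _ _ _ _ _ _
    refine ⟨(eval (psi L (2 ^ i * b)) (rPoly L) - eval (psi L (2 ^ i * a)) (rPoly L)) + 2 * C,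
      hc.add (isAlgebraic_two.mul hC), ?_⟩
    obtain ⟨K, ρ, cf, hρ, hcf, hsum⟩ := span_add hdesc (span_smul isAlgebraic_two hih)
    refine ⟨K, ρ, cf, hρ, hcf, ?_⟩
    rw [← hsum, e, pow_succ', ← smul_smul, smul_sub, smul_sub, add_smul, ← smul_smul]
    abel

end Descent

/-! ### After `2k` doublings a unit step of `G_{2k}` becomes a basic loop -/

/-- `3 ∣ 4ᵏ − 1`. [folklore] -/
theorem exists_four_pow_sub_one (k : ℕ) : ∃ q : ℤ, (4 : ℤ) ^ k - 1 = 3 * q := by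
  obtain ⟨q, hq⟩ := sub_dvd_pow_sub_pow (4 : ℤ) 1 k
  exact ⟨q, by rw [one_pow] at hq; rw [hq]; norm_num⟩

/-- `2^{2k} (1/3 + m/2^{2k}) = 1/3 + ((4ᵏ − 1)/3 + m)`. [folklore] -/
theorem two_pow_mul_gc_eq (k : ℕ) (m : ℤ) {q : ℤ} (hq : (4 : ℤ) ^ k - 1 = 3 * q) :
    (2 : ℂ) ^ (2 * k) * ((gc (2 * k) m : ℝ) : ℂ) = 1 / 3 + ((q + m : ℤ) : ℂ) := by
  have h4 : (2 : ℂ) ^ (2 * k) = 4 ^ k := by rw [pow_mul]; norm_num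
  have hq' : ((4 : ℂ) ^ k) = 3 * q + 1 := by
    have h := congrArg (fun z : ℤ => (z : ℂ)) hq
    push_cast at h
    linear_combination h
  have h4ne : (4 : ℂ) ^ k ≠ 0 := pow_ne_zero _ (by norm_num)
  unfold gc
  push_cast
  rw [h4, mul_add, mul_div_cancel₀ _ h4ne, hq']
  ring

/-- **`2^{2k} · vtx_{2k}(μ) ≡ g₀ = vtx₀(0,0) (mod Λ)`** (as `4ᵏ ≡ 1 (mod 3)`). [folklore] -/
theorem two_pow_mul_vtx_sub_mem (k : ℕ) (μ : ℤ × ℤ) :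
    2 ^ (2 * k) * vtx L (2 * k) μ - vtx L 0 (0, 0) ∈ L.lattice := by
  obtain ⟨q, hq⟩ := exists_four_pow_sub_one k
  rw [PeriodPair.mem_lattice]
  refine ⟨q + μ.1, q + μ.2, ?_⟩
  have h1 := two_pow_mul_gc_eq k μ.1 hq
  have h2 := two_pow_mul_gc_eq k μ.2 hq
  have h0 : ((gc 0 0 : ℝ) : ℂ) = 1 / 3 := by unfold gc; push_cast; ring
  simp only [vtx]
  rw [h0, mul_add, ← mul_assoc, ← mul_assoc, h1, h2]
  ring

/-- The scaled step and the basic loop have the same direction vector: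
`2^{2k}(vtx (nbr μ j) − vtx μ) = ω_j = vtx₀(nbr (0,0) j) − vtx₀(0,0)`. [folklore] -/
theorem two_pow_mul_vtx_nbr_sub (k : ℕ) (μ : ℤ × ℤ) (j : Fin 2) :
    2 ^ (2 * k) * vtx L (2 * k) (nbr μ j) - vtx L 0 (nbr (0, 0) j) =
      2 ^ (2 * k) * vtx L (2 * k) μ - vtx L 0 (0, 0) := by
  have h2 : (2 : ℂ) ^ (2 * k) ≠ 0 := pow_ne_zero _ two_ne_zero
  have e0 : 2 ^ (2 * k) * vtx L (2 * k) (nbr μ 0) - vtx L 0 (nbr (0, 0) 0) =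
      2 ^ (2 * k) * vtx L (2 * k) μ - vtx L 0 (0, 0) := by
    simp only [vtx, gc, nbr_zero]
    push_cast
    field_simp
    ring
  have e1 : 2 ^ (2 * k) * vtx L (2 * k) (nbr μ 1) - vtx L 0 (nbr (0, 0) 1) =
      2 ^ (2 * k) * vtx L (2 * k) μ - vtx L 0 (0, 0) := by
    simp only [vtx, gc, nbr_one]
    push_cast
    field_simp
    ring
  fin_cases j
  exacts [e0, e1]

section Steps

variable (h₂ : IsAlgebraic ℚ L.g₂) (h₃ : IsAlgebraic ℚ L.g₃)
include h₂ h₃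

/-- **The `2k`-fold double of a unit step of `G_{2k}` IS the basic loop** `φ∘[g₀, g₀ + ω_j]`
(= the unit step of `G₀` at `(0,0)`), literally, by `Λ`-periodicity of `φ`. [folklore] -/
theorem segPath_two_pow_step (k : ℕ) (μ : ℤ × ℤ) (j : Fin 2)
    (hAB : ∀ t ∈ Icc (0 : ℝ) 1, 2 ^ (2 * k) * vtx L (2 * k) μ +
        t * (2 ^ (2 * k) * vtx L (2 * k) (nbr μ j) - 2 ^ (2 * k) * vtx L (2 * k) μ) ∉ L.lattice)
    (hA : IsAlgPt L (2 ^ (2 * k) * vtx L (2 * k) μ))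
    (hB : IsAlgPt L (2 ^ (2 * k) * vtx L (2 * k) (nbr μ j))) :
    segPath hAB hA hB = stepPath L h₂ h₃ 0 (0, 0) j :=
  segPath_eq_of_translate L (two_pow_mul_vtx_sub_mem L k μ) (two_pow_mul_vtx_nbr_sub L k μ j)
    (step_notMem L 0 (0, 0) j) hAB (isAlgPt_vtx L h₂ h₃ 0 (0, 0))
    (isAlgPt_vtx L h₂ h₃ 0 (nbr (0, 0) j)) hA hB

/-- `2^{2k} · vtx` is an algebraic point. [folklore] -/
theorem isAlgPt_two_pow_mul_vtx (k : ℕ) (μ : ℤ × ℤ) (j : Fin 2) :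
    IsAlgPt L (2 ^ (2 * k) * vtx L (2 * k) μ) ∧
      IsAlgPt L (2 ^ (2 * k) * vtx L (2 * k) (nbr μ j)) := by
  have hall := fun i => two_pow_mul_step_notMem L i (2 * k) μ j
  have hI0 : (0 : ℝ) ∈ Icc (0 : ℝ) 1 := ⟨le_rfl, zero_le_one⟩
  have hI1 : (1 : ℝ) ∈ Icc (0 : ℝ) 1 := ⟨zero_le_one, le_rfl⟩
  refine ⟨IsAlgPt.two_pow_mul L h₂ (isAlgPt_vtx L h₂ h₃ (2 * k) μ) (fun i => ?_) (2 * k),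
    IsAlgPt.two_pow_mul L h₂ (isAlgPt_vtx L h₂ h₃ (2 * k) (nbr μ j)) (fun i => ?_) (2 * k)⟩
  · simpa using hall i 0 hI0
  · simpa using hall i 1 hI1

omit h₂ h₃ in
/-- The `2k`-fold doubled step avoids `Λ`. [folklore] -/
theorem two_pow_step_notMem (k : ℕ) (μ : ℤ × ℤ) (j : Fin 2) :
    ∀ t ∈ Icc (0 : ℝ) 1, 2 ^ (2 * k) * vtx L (2 * k) μ +
        t * (2 ^ (2 * k) * vtx L (2 * k) (nbr μ j) - 2 ^ (2 * k) * vtx L (2 * k) μ) ∉ L.lattice :=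
  fun t ht => by rw [two_pow_seg]; exact two_pow_mul_step_notMem L (2 * k) (2 * k) μ j t ht

omit h₂ h₃ in
/-- `±(2^{2k})⁻¹ ∈ ℚ̄`. [folklore] -/
theorem isAlgebraic_neg_inv_two_pow (k : ℕ) : IsAlgebraic ℚ (-((2 : ℂ) ^ (2 * k))⁻¹) :=
  (isAlgebraic_two.pow _).inv.neg

/-- **A unit step of `G_{2k}` is `4⁻ᵏ` times a basic loop, for `θ₀`**:
`(E_L, θ₀, step_{2k}(μ, j)) − 4⁻ᵏ (E_L, θ₀, φ∘[g₀, g₀ + ω_j])` lies in the span.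
[cite: HuberWustholz2022, §13.1 (B) (p. 120), §18.1 (p. 160)] -/
theorem span_stepSym_theta0 (k : ℕ) (μ : ℤ × ℤ) (j : Fin 2) :
    InSpan (Finsupp.single (stepSym L h₂ h₃ (theta0 L) (hasAlgCoeffs_theta0 L h₂ h₃) (2 * k) (μ, j))
        (1 : ℂ) -
      ((2 : ℂ) ^ (2 * k))⁻¹ • Finsupp.single (stepSym L h₂ h₃ (theta0 L)
        (hasAlgCoeffs_theta0 L h₂ h₃) 0 ((0, 0), j)) 1) := by
  obtain ⟨hA, hB⟩ := isAlgPt_two_pow_mul_vtx L h₂ h₃ k μ j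
  have hAB := two_pow_step_notMem L k μ j
  have hdesc := span_descent_theta0_iter L h₂ h₃ (2 * k)
    (fun i => two_pow_mul_step_notMem L i (2 * k) μ j) (isAlgPt_vtx L h₂ h₃ (2 * k) μ)
    (isAlgPt_vtx L h₂ h₃ (2 * k) (nbr μ j)) (step_notMem L (2 * k) μ j) hAB hA hB
  have e := segPath_two_pow_step L h₂ h₃ k μ j hAB hA hB
  have h2 : (2 : ℂ) ^ (2 * k) ≠ 0 := pow_ne_zero _ two_ne_zero
  obtain ⟨K, ρ, cf, hρ, hcf, hsum⟩ := span_smul (isAlgebraic_neg_inv_two_pow k) hdesc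
  refine ⟨K, ρ, cf, hρ, hcf, ?_⟩
  rw [← hsum, e]
  simp only [stepSym, stepPath, smul_sub, smul_smul, neg_mul, inv_mul_cancel₀ h2, neg_smul, one_smul]
  abel

/-- **A unit step of `G_{2k}` is `4⁻ᵏ` times a basic loop plus a constant, for `θ₁`**:
`(E_L, θ₁, step_{2k}(μ, j)) − 4⁻ᵏ (E_L, θ₁, φ∘[g₀, g₀ + ω_j]) − C · 𝟙` lies in the span for some
`C ∈ ℚ̄`. [cite: HuberWustholz2022, §13.1 (B) (p. 120), §18.1 (p. 160)] -/
theorem span_stepSym_theta1 (k : ℕ) (μ : ℤ × ℤ) (j : Fin 2) :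
    ∃ C : ℂ, IsAlgebraic ℚ C ∧
    InSpan (Finsupp.single (stepSym L h₂ h₃ (theta1 L) (hasAlgCoeffs_theta1 L h₂ h₃) (2 * k) (μ, j))
        (1 : ℂ) -
      ((2 : ℂ) ^ (2 * k))⁻¹ • Finsupp.single (stepSym L h₂ h₃ (theta1 L)
        (hasAlgCoeffs_theta1 L h₂ h₃) 0 ((0, 0), j)) 1 -
      C • Finsupp.single PeriodSymbol.unit (1 : ℂ)) := by
  obtain ⟨hA, hB⟩ := isAlgPt_two_pow_mul_vtx L h₂ h₃ k μ j
  have hAB := two_pow_step_notMem L k μ j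
  obtain ⟨C₀, hC₀, hdesc⟩ := span_descent_theta1_iter L h₂ h₃ (2 * k)
    (fun i => two_pow_mul_step_notMem L i (2 * k) μ j) (isAlgPt_vtx L h₂ h₃ (2 * k) μ)
    (isAlgPt_vtx L h₂ h₃ (2 * k) (nbr μ j)) (step_notMem L (2 * k) μ j) hAB hA hB
  have e := segPath_two_pow_step L h₂ h₃ k μ j hAB hA hB
  have h2 : (2 : ℂ) ^ (2 * k) ≠ 0 := pow_ne_zero _ two_ne_zero
  refine ⟨-((2 : ℂ) ^ (2 * k))⁻¹ * C₀, (isAlgebraic_neg_inv_two_pow k).mul hC₀, ?_⟩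
  obtain ⟨K, ρ, cf, hρ, hcf, hsum⟩ := span_smul (isAlgebraic_neg_inv_two_pow k) hdesc
  refine ⟨K, ρ, cf, hρ, hcf, ?_⟩
  rw [← hsum, e]
  simp only [stepSym, stepPath, smul_sub, smul_smul, neg_mul, inv_mul_cancel₀ h2, neg_smul, one_smul]
  abel

end Steps

/-! ### The four basic symbols and the loop part of a combination -/

section NormalForm

variable (h₂ : IsAlgebraic ℚ L.g₂) (h₃ : IsAlgebraic ℚ L.g₃)
include h₂ h₃

/-- **Periods of the basic loops, first kind**: `∫_{φ∘[g₀, g₀+ω_j]} θ₀ = 2ω_j`.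
[cite: HuberWustholz2022, §18.1 (p. 160)] -/
theorem period_stepSym_theta0_zero (j : Fin 2) :
    (stepSym L h₂ h₃ (theta0 L) (hasAlgCoeffs_theta0 L h₂ h₃) 0 ((0, 0), j)).period =
      2 * ![L.ω₁, L.ω₂] j := by
  have h0 : (stepSym L h₂ h₃ (theta0 L) (hasAlgCoeffs_theta0 L h₂ h₃) 0 ((0, 0), 0)).period =
      2 * L.ω₁ := by
    simp only [stepSym, stepPath]
    rw [period_theta0_segPath h₂ h₃]
    simp only [vtx, gc, nbr_zero]
    push_cast
    ring
  have h1 : (stepSym L h₂ h₃ (theta0 L) (hasAlgCoeffs_theta0 L h₂ h₃) 0 ((0, 0), 1)).period =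
      2 * L.ω₂ := by
    simp only [stepSym, stepPath]
    rw [period_theta0_segPath h₂ h₃]
    simp only [vtx, gc, nbr_one]
    push_cast
    ring
  fin_cases j
  exacts [h0, h1]

/-- **Periods of the basic loops, second kind**: `∫_{φ∘[g₀, g₀+ω_j]} θ₁ = −2η_j`.
[cite: HuberWustholz2022, §18.1 (p. 160)] -/
theorem period_stepSym_theta1_zero (j : Fin 2) :
    (stepSym L h₂ h₃ (theta1 L) (hasAlgCoeffs_theta1 L h₂ h₃) 0 ((0, 0), j)).period =
      -2 * ![L.η₁, L.η₂] j := by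
  have h0 : (stepSym L h₂ h₃ (theta1 L) (hasAlgCoeffs_theta1 L h₂ h₃) 0 ((0, 0), 0)).period =
      -2 * L.η₁ := by
    simp only [stepSym, stepPath]
    rw [period_theta1_segPath h₂ h₃]
    have e : vtx L 0 (nbr (0, 0) 0) = vtx L 0 (0, 0) + ((1 : ℤ) : ℂ) * L.ω₁ := by
      simp only [vtx, gc, nbr_zero]
      push_cast
      ring
    rw [e, L.weierstrassZeta_add_int_mul_ω₁]
    push_cast
    ring
  have h1 : (stepSym L h₂ h₃ (theta1 L) (hasAlgCoeffs_theta1 L h₂ h₃) 0 ((0, 0), 1)).period =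
      -2 * L.η₂ := by
    simp only [stepSym, stepPath]
    rw [period_theta1_segPath h₂ h₃]
    have e : vtx L 0 (nbr (0, 0) 1) = vtx L 0 (0, 0) + ((1 : ℤ) : ℂ) * L.ω₂ := by
      simp only [vtx, gc, nbr_one]
      push_cast
      ring
    rw [e, L.weierstrassZeta_add_int_mul_ω₂]
    push_cast
    ring
  fin_cases j
  exacts [h0, h1]

/-- **The loop part** `Σ_j A_j · (E_L, θ₀, φ∘[g₀, g₀+ω_j]) + Σ_j B_j · (E_L, θ₁, φ∘[g₀, g₀+ω_j])` of
a combination: the normal form of closed-path symbols on `E_L`. [folklore] -/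
def loopPart (A B : Fin 2 → ℂ) : PeriodSymbol →₀ ℂ :=
  ∑ j, A j • Finsupp.single (stepSym L h₂ h₃ (theta0 L) (hasAlgCoeffs_theta0 L h₂ h₃) 0 ((0, 0), j))
      (1 : ℂ) +
    ∑ j, B j • Finsupp.single (stepSym L h₂ h₃ (theta1 L) (hasAlgCoeffs_theta1 L h₂ h₃) 0 ((0, 0), j))
      (1 : ℂ)

/-- `loopPart 0 0 = 0`. [folklore] -/
theorem loopPart_zero : loopPart L h₂ h₃ 0 0 = 0 := by
  simp [loopPart]

/-- `loopPart` is additive. [folklore] -/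
theorem loopPart_add (A B A' B' : Fin 2 → ℂ) :
    loopPart L h₂ h₃ A B + loopPart L h₂ h₃ A' B' = loopPart L h₂ h₃ (A + A') (B + B') := by
  simp only [loopPart, Pi.add_apply, add_smul, Finset.sum_add_distrib]
  abel

/-- `loopPart` is homogeneous. [folklore] -/
theorem smul_loopPart (x : ℂ) (A B : Fin 2 → ℂ) :
    x • loopPart L h₂ h₃ A B = loopPart L h₂ h₃ (x • A) (x • B) := by
  simp only [loopPart, smul_add, Finset.smul_sum, smul_smul, Pi.smul_apply, smul_eq_mul]

/-- `loopPart` of a finite sum. [folklore] -/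
theorem loopPart_finset_sum {ι : Type*} (T : Finset ι) (A B : ι → Fin 2 → ℂ) :
    ∑ s ∈ T, loopPart L h₂ h₃ (A s) (B s) = loopPart L h₂ h₃ (∑ s ∈ T, A s) (∑ s ∈ T, B s) := by
  classical
  induction T using Finset.induction_on with
  | empty => simp [loopPart_zero]
  | insert a T ha ih => rw [Finset.sum_insert ha, Finset.sum_insert ha, Finset.sum_insert ha, ih,
      loopPart_add]

/-- **The period of the loop part**: `2(A₀ω₁ + A₁ω₂) − 2(B₀η₁ + B₁η₂)`.
[cite: HuberWustholz2022, §18.1 (p. 160)] -/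
theorem evalCombination_loopPart (A B : Fin 2 → ℂ) :
    evalCombination (loopPart L h₂ h₃ A B) =
      2 * (A 0 * L.ω₁ + A 1 * L.ω₂) - 2 * (B 0 * L.η₁ + B 1 * L.η₂) := by
  simp only [loopPart, evalCombination_add, Fin.sum_univ_two,
    evalCombination_smul, evalCombination_single, period_stepSym_theta0_zero,
    period_stepSym_theta1_zero]
  simp
  ring

omit h₂ h₃ in
/-- Regrouping a sum over steps by direction. [folklore] -/
theorem sum_smul_single_dir {S : Finset ((ℤ × ℤ) × Fin 2)} (w : (ℤ × ℤ) × Fin 2 → ℂ)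
    (v : Fin 2 → (PeriodSymbol →₀ ℂ)) :
    ∑ x ∈ S, w x • v x.2 = ∑ j, (∑ x ∈ S, if x.2 = j then w x else 0) • v j := by
  classical
  simp_rw [Finset.sum_smul, ite_smul, zero_smul]
  rw [Finset.sum_comm]
  refine Finset.sum_congr rfl fun x _ => ?_
  rw [Finset.sum_ite_eq]
  simp

/-- **Normal form of a step combination**: `F_{2k}(c)(θ₀) ∼ Σ_j A_j α_j` and
`F_{2k}(c)(θ₁) ∼ Σ_j A_j β_j + e · 𝟙` with `A_j = 4⁻ᵏ Σ_{steps x of direction j} c(x) ∈ ℚ` and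
`e ∈ ℚ̄`. [cite: HuberWustholz2022, §13.1 (B) (p. 120), §3.3.1 (pp. 42–44)] -/
theorem exists_stepComb_normalForm (k : ℕ) (c : (ℤ × ℤ) × Fin 2 →₀ ℤ) :
    ∃ (A : Fin 2 → ℂ) (e : ℂ), (∀ j, IsAlgebraic ℚ (A j)) ∧ IsAlgebraic ℚ e ∧
      InSpan (stepComb L h₂ h₃ (theta0 L) (hasAlgCoeffs_theta0 L h₂ h₃) (2 * k) c -
        ∑ j, A j • Finsupp.single (stepSym L h₂ h₃ (theta0 L) (hasAlgCoeffs_theta0 L h₂ h₃) 0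
          ((0, 0), j)) (1 : ℂ)) ∧
      InSpan (stepComb L h₂ h₃ (theta1 L) (hasAlgCoeffs_theta1 L h₂ h₃) (2 * k) c -
        ∑ j, A j • Finsupp.single (stepSym L h₂ h₃ (theta1 L) (hasAlgCoeffs_theta1 L h₂ h₃) 0
          ((0, 0), j)) (1 : ℂ) -
        e • Finsupp.single PeriodSymbol.unit (1 : ℂ)) := by
  classical
  choose C hC hrel1 using fun x : (ℤ × ℤ) × Fin 2 => span_stepSym_theta1 L h₂ h₃ k x.1 x.2
  have hrel0 := fun x : (ℤ × ℤ) × Fin 2 => span_stepSym_theta0 L h₂ h₃ k x.1 x.2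
  set w : (ℤ × ℤ) × Fin 2 → ℂ := fun x => (c x : ℂ) * ((2 : ℂ) ^ (2 * k))⁻¹ with hw
  have hwalg : ∀ x, IsAlgebraic ℚ (w x) := fun x =>
    (isAlgebraic_int (c x)).mul (isAlgebraic_two.pow _).inv
  have hcalg : ∀ x, IsAlgebraic ℚ ((c x : ℤ) : ℂ) := fun x => isAlgebraic_int (c x)
  refine ⟨fun j => ∑ x ∈ c.support, if x.2 = j then w x else 0, ∑ x ∈ c.support, (c x : ℂ) * C x,
    fun j => isAlgebraic_finsetSum _ _ fun x _ => ?_,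
    isAlgebraic_finsetSum _ _ fun x _ => (hcalg x).mul (hC x), ?_, ?_⟩
  · split_ifs
    · exact hwalg x
    · exact isAlgebraic_zero
  · -- `θ₀`
    have hsum : InSpan (∑ x ∈ c.support, (c x : ℂ) •
        (Finsupp.single (stepSym L h₂ h₃ (theta0 L) (hasAlgCoeffs_theta0 L h₂ h₃) (2 * k) (x.1, x.2))
            (1 : ℂ) -
          ((2 : ℂ) ^ (2 * k))⁻¹ • Finsupp.single (stepSym L h₂ h₃ (theta0 L)
            (hasAlgCoeffs_theta0 L h₂ h₃) 0 ((0, 0), x.2)) 1)) :=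
      span_finsetSum _ _ fun x _ => span_smul (hcalg x) (hrel0 x)
    rw [← sum_smul_single_dir]
    obtain ⟨K, ρ, cf, hρ, hcf, he⟩ := hsum
    refine ⟨K, ρ, cf, hρ, hcf, ?_⟩
    rw [← he]
    simp only [stepComb, Finsupp.sum, hw, smul_sub, smul_smul, Finset.sum_sub_distrib, Prod.mk.eta]
  · -- `θ₁`
    have hsum : InSpan (∑ x ∈ c.support, (c x : ℂ) •
        (Finsupp.single (stepSym L h₂ h₃ (theta1 L) (hasAlgCoeffs_theta1 L h₂ h₃) (2 * k) (x.1, x.2))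
            (1 : ℂ) -
          ((2 : ℂ) ^ (2 * k))⁻¹ • Finsupp.single (stepSym L h₂ h₃ (theta1 L)
            (hasAlgCoeffs_theta1 L h₂ h₃) 0 ((0, 0), x.2)) 1 -
          C x • Finsupp.single PeriodSymbol.unit (1 : ℂ))) :=
      span_finsetSum _ _ fun x _ => span_smul (hcalg x) (hrel1 x)
    rw [← sum_smul_single_dir]
    obtain ⟨K, ρ, cf, hρ, hcf, he⟩ := hsum
    refine ⟨K, ρ, cf, hρ, hcf, ?_⟩
    rw [← he]
    simp only [stepComb, Finsupp.sum, hw, smul_sub, smul_smul, Finset.sum_sub_distrib, Prod.mk.eta,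
      Finset.sum_smul]

/-- **Normal form of a closed path on `E_L`.** For every closed `C¹` path `γ` on `E_L` with
algebraic base point and every polynomial `1`-form `ω` over `ℚ̄`, the symbol `(E_L, ω, γ)` is,
modulo the `ℚ̄`-span of the elementary relations,
`Σ_j A_j (E_L, θ₀, φ∘[g₀, g₀+ω_j]) + Σ_j B_j (E_L, θ₁, φ∘[g₀, g₀+ω_j]) + e · 𝟙` with
`A_j, B_j, e ∈ ℚ̄` — the de Rham reduction `ω ∼ aθ₀ + bθ₁ + dP + ν`
(`Weier.exists_rel_symbol`), the normal form of the closed path as a step combination of the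
torsion grid `G_{2k}` (`Ell.exists_stepComb_of_closed`) and the `2k`-fold doubling descent of
every step to the basic loops (`exists_stepComb_normalForm`). Its period is accordingly
`2(A₀ω₁ + A₁ω₂) − 2(B₀η₁ + B₁η₂) + e`.
[cite: HuberWustholz2022, §3.3.1 (pp. 42–44), §13.2 (p. 123), §18.1 (p. 160)] -/
theorem exists_loop_normalForm (γ : CurvePath (curve L)) (hcl : γ.toFun 1 = γ.toFun 0)
    (ω : Fin 2 → MvPolynomial (Fin 2) ℂ) (hω : ∀ i, HasAlgCoeffs (ω i)) :
    ∃ (A B : Fin 2 → ℂ) (e : ℂ), (∀ j, IsAlgebraic ℚ (A j)) ∧ (∀ j, IsAlgebraic ℚ (B j)) ∧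
      IsAlgebraic ℚ e ∧
      InSpan (Finsupp.single (⟨curve L, smooth L h₂ h₃, ω, hω, γ⟩ : PeriodSymbol) (1 : ℂ) -
        loopPart L h₂ h₃ A B - e • Finsupp.single PeriodSymbol.unit (1 : ℂ)) := by
  obtain ⟨k, c, hkc⟩ := exists_stepComb_of_closed L h₂ h₃ γ hcl
  obtain ⟨A', e', hA', he', hF0, hF1⟩ := exists_stepComb_normalForm L h₂ h₃ k c
  obtain ⟨a, b, e₀, ha, hb, he₀, hrel⟩ := Weier.exists_rel_symbol (A L) (B L) (isAlgebraic_A L h₂)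
    (isAlgebraic_B L h₃) (disc_ne_zero L) ω hω γ
  have hg0 := hkc (theta0 L) (hasAlgCoeffs_theta0 L h₂ h₃)
  have hg1 := hkc (theta1 L) (hasAlgCoeffs_theta1 L h₂ h₃)
  refine ⟨a • A', b • A', b * e' + e₀, fun j => ha.mul (hA' j), fun j => hb.mul (hA' j),
    (hb.mul he').add he₀, ?_⟩
  obtain ⟨K, ρ, cf, hρ, hcf, hsum⟩ :=
    span_add (span_add hrel (span_smul ha (span_add hg0 hF0))) (span_smul hb (span_add hg1 hF1))
  refine ⟨K, ρ, cf, hρ, hcf, ?_⟩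
  rw [← hsum]
  simp only [loopPart, smul_add, smul_sub, Finset.smul_sum, smul_smul, Pi.smul_apply, smul_eq_mul,
    add_smul]
  abel

end NormalForm

end Ell

/-! ### The theorem: closed paths on `E_L`, with `𝔾ₘ` and `𝔸¹`, from the analytic subgroup theorem -/

section Main

local notation3 "logSym " E:arg => (⟨⟨2, 1, ![X 0 * X 1 - 1]⟩, isSmoothAffineCurve_mulGroup,
  ![X 1, 0], hasAlgCoeffs_ydx, E⟩ : PeriodSymbol)

/-- `ℚ`-linearly independent numbers admit no non-trivial integer relation. [folklore] -/
theorem not_int_rel_of_linearIndependent {ι : Type*} [Fintype ι] {m : ι → ℂ}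
    (hli : LinearIndependent ℚ m) (p : ι → ℤ) (hp : p ≠ 0)
    (hrel : ∑ i, (p i : ℂ) * m i = 0) : False := by
  have hsum : ∑ i, ((p i : ℚ)) • m i = 0 := by
    have h : ∀ i, ((p i : ℚ)) • m i = (p i : ℂ) * m i := fun i => by
      rw [Rat.smul_def]
      push_cast
      rfl
    simp_rw [h]
    exact hrel
  have h0 := Fintype.linearIndependent_iff.mp hli _ hsum
  exact hp (funext fun i => by exact_mod_cast h0 i)

/-- **Huber–Wüstholz, Theorem 13.3 (2), for closed paths on a non-CM elliptic curve together with
`𝔾ₘ` and `𝔸¹` — from the analytic subgroup theorem at period vectors.** Let `Λ` be a lattice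
with algebraic invariants `g₂, g₃` and without complex multiplication, and
`E_L : y² = x³ − (g₂/4)x − g₃/4` its affine Weierstrass curve. Assume Wüstholz's analytic subgroup
theorem for `𝔾ₐ × 𝔾ₘ^ι × (E♮)²` at period vectors (the named fact
`analyticSubgroupTheorem_GaGmE_periods` of `AnalyticSubgroupElliptic.lean`, taken as a
hypothesis). Then every vanishing `ℚ̄`-linear combination of period symbols `(E_L, ω, γ)` with
`γ` CLOSED (any polynomial `1`-form `ω` over `ℚ̄`, any `C¹` loop at an algebraic point),
`(𝔾ₘ, ω, γ)` and `(𝔸¹, ω, γ)` (arbitrary `C¹` paths with algebraic end points) is a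
`ℚ̄`-linear combination of the elementary relations (R1)–(R5). The periods in question are the
`ℚ̄`-combinations of `1`, `ω₁, ω₂, η₁, η₂` and logarithms of algebraic numbers (among them `2πi`);
modulo the relations every symbol is `Σ A_j α_j + Σ B_j β_j + Σ D_i ℓ(m_i) + e · 𝟙`
(`Ell.exists_loop_normalForm`, `exists_logSym_rel`, `span_logSym_sum` with a `ℚ`-basis `m_i` of
the logarithms), whose period `2(A₀ω₁ + A₁ω₂) − 2(B₀η₁ + B₁η₂) + Σ D_i m_i + e` vanishes; the
analytic subgroup theorem applied to `u = (1; (m_i); (ω₁, η₁), (ω₂, η₂)) ∈ Lie(𝔾ₐ × 𝔾ₘ^ι × (E♮)²)`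
(whose degenerate alternatives are excluded by `1 ≠ 0`, the `ℚ`-independence of the `m_i` and
the `ℝ`-independence of `ω₁, ω₂`) forces all coefficients to vanish. This is the deduction of
the book's Thm. 13.3 (2) for the sub-diagram `{E_L} ∪ {𝔾ₘ, 𝔸¹}` with closed paths on `E_L`
(§13.2, Thm. 13.9; Ch. 15, Thm. 15.3 (1) for `[ℤ → 𝔾ₘ] × h¹(E)`), made unconditional up to the
one named fact. [cite: HuberWustholz2022, Thm. 13.3 (2) (p. 121), §13.2 and Thm. 13.9 (pp. 122–125), Thm. 15.3 (1), §18.1 (p. 160)] -/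
theorem huberWustholzCurvePeriods_of_ellipticLoops (hAST : analyticSubgroupTheorem_GaGmE_periods)
    (L : PeriodPair) (h₂ : IsAlgebraic ℚ L.g₂) (h₃ : IsAlgebraic ℚ L.g₃) (hCM : ¬ L.HasCM)
    (c : PeriodSymbol →₀ ℂ) (hc : ∀ s, IsAlgebraic ℚ (c s))
    (hsupp : ∀ s ∈ c.support,
      (s.Z = Ell.curve L ∧ s.γ.toFun 1 = s.γ.toFun 0) ∨
        s.Z = (⟨2, 1, ![X 0 * X 1 - 1]⟩ : CurveData) ∨ s.Z = CurveData.affineLine)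
    (h0 : evalCombination c = 0) :
    ∃ (k : ℕ) (ρ : Fin k → (PeriodSymbol →₀ ℂ)) (a : Fin k → ℂ),
      (∀ l, IsElementaryRelation (ρ l)) ∧ (∀ l, IsAlgebraic ℚ (a l)) ∧ c = ∑ l, a l • ρ l := by
  classical
  obtain ⟨E00, hE00⟩ := exists_expPath (L₀ := 0) (L₁ := 0) isAlgebraic_exp_zero isAlgebraic_exp_zero
  -- Step 1: every symbol of `c` is `loopPart A B + d ℓ(M) + e 𝟙` modulo relations
  have key : ∀ s : PeriodSymbol, ∃ (Ac Bc : Fin 2 → ℂ) (M : ℂ)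
      (E : CurvePath (⟨2, 1, ![X 0 * X 1 - 1]⟩ : CurveData)) (d e : ℂ), s ∈ c.support →
      ((∀ j, IsAlgebraic ℚ (Ac j)) ∧ (∀ j, IsAlgebraic ℚ (Bc j)) ∧ IsAlgebraic ℚ (exp M) ∧
        (∀ t, E.toFun t = ![exp ((1 - t) * 0 + t * M), exp (-((1 - t) * 0 + t * M))]) ∧
        IsAlgebraic ℚ d ∧ IsAlgebraic ℚ e ∧
        InSpan (Finsupp.single s (1 : ℂ) - Ell.loopPart L h₂ h₃ Ac Bc -
          d • Finsupp.single (logSym E) (1 : ℂ) -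
          e • Finsupp.single PeriodSymbol.unit (1 : ℂ))) := by
    intro s
    by_cases hs : s ∈ c.support
    · rcases hsupp s hs with ⟨hsZ, hcl⟩ | hGA
      · obtain ⟨Z, hZ, ω, hω, γ⟩ := s
        dsimp only at hsZ hcl
        subst hsZ
        obtain rfl : hZ = Ell.smooth L h₂ h₃ := rfl
        obtain ⟨Ac, Bc, e, hA, hB, he, hrel⟩ := Ell.exists_loop_normalForm L h₂ h₃ γ hcl ω hω
        refine ⟨Ac, Bc, 0, E00, 0, e, fun _ =>
          ⟨hA, hB, isAlgebraic_exp_zero, hE00, isAlgebraic_zero, he, ?_⟩⟩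
        obtain ⟨k, ρ, a, hρ, ha, hsum⟩ := hrel
        exact ⟨k, ρ, a, hρ, ha, by rw [← hsum, zero_smul, sub_zero]⟩
      · obtain ⟨M, E, d, e, h1, h2, h3, h4, h5⟩ := exists_logSym_rel s hGA
        refine ⟨0, 0, M, E, d, e, fun _ =>
          ⟨fun _ => isAlgebraic_zero, fun _ => isAlgebraic_zero, h1, h2, h3, h4, ?_⟩⟩
        obtain ⟨k, ρ, a, hρ, ha, hsum⟩ := h5
        exact ⟨k, ρ, a, hρ, ha, by rw [← hsum, Ell.loopPart_zero, sub_zero]⟩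
    · exact ⟨0, 0, 0, E00, 0, 0, fun h => (hs h).elim⟩
  choose Ac Bc M E d e hkey using key
  -- Step 2: a `ℚ`-basis of the `ℚ`-span of the logarithms `M_s`
  set S : Finset ℂ := c.support.image M with hS
  obtain ⟨b, hbS, hspan, hli⟩ := exists_linearIndependent ℚ (↑S : Set ℂ)
  have hbfin : b.Finite := S.finite_toSet.subset hbS
  set Bs : Finset ℂ := hbfin.toFinset with hBs
  have hBb : (↑Bs : Set ℂ) = b := hbfin.coe_toFinset
  have halgB : ∀ m : Bs, IsAlgebraic ℚ (exp (m : ℂ)) := by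
    rintro ⟨m, hm⟩
    have hm' : m ∈ S := by
      have : m ∈ b := by rw [← hBb]; exact hm
      exact hbS this
    obtain ⟨s, hs, rfl⟩ := Finset.mem_image.1 hm'
    exact (hkey s hs).2.2.1
  have hliB : LinearIndependent ℚ (fun m : Bs => (m : ℂ)) := by
    rw [← hBb] at hli
    exact hli
  have keyB : ∀ m : Bs, ∃ Em : CurvePath (⟨2, 1, ![X 0 * X 1 - 1]⟩ : CurveData),
      ∀ t, Em.toFun t = ![exp ((1 - t) * 0 + t * (m : ℂ)), exp (-((1 - t) * 0 + t * (m : ℂ)))] :=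
    fun m => exists_expPath (L₀ := 0) (L₁ := (m : ℂ)) isAlgebraic_exp_zero (halgB m)
  choose Em hEm using keyB
  -- Step 3: rational coordinates of each `M_s` in the basis
  have keyq : ∀ s : PeriodSymbol, ∃ q : Bs → ℚ, s ∈ c.support →
      ∑ i, (q i : ℂ) * (i : ℂ) = M s := by
    intro s
    by_cases hs : s ∈ c.support
    · have hmem : M s ∈ Submodule.span ℚ (Set.range fun m : Bs => (m : ℂ)) := by
        have hrange : Set.range (fun m : Bs => (m : ℂ)) = (↑Bs : Set ℂ) := Subtype.range_coe
        rw [hrange, hBb, hspan]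
        exact Submodule.subset_span (Finset.mem_coe.2 (Finset.mem_image_of_mem M hs))
      obtain ⟨q, hq⟩ := (Submodule.mem_span_range_iff_exists_fun ℚ).1 hmem
      refine ⟨q, fun _ => ?_⟩
      rw [← hq]
      exact Finset.sum_congr rfl fun i _ => by rw [Rat.smul_def]
    · exact ⟨0, fun h => (hs h).elim⟩
  choose q hq using keyq
  -- Step 4: per symbol, `s ∼ loopPart + Σ_i (d_s q_{s,i}) ℓ(i) + e_s 𝟙`
  have hper_s : ∀ s ∈ c.support, InSpan (Finsupp.single s (1 : ℂ) - Ell.loopPart L h₂ h₃ (Ac s) (Bc s) -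
      d s • ∑ i : Bs, (q s i : ℂ) • Finsupp.single (logSym (Em i)) (1 : ℂ) -
      e s • Finsupp.single PeriodSymbol.unit (1 : ℂ)) := by
    intro s hs
    obtain ⟨_, _, _, hEs, hds, _, hrel⟩ := hkey s hs
    have hsum := span_logSym_sum (Finset.univ : Finset Bs) (fun m : Bs => (m : ℂ)) halgB (q s) Em
      (fun i t => hEm i t) (E s) (fun t => by rw [hEs, hq s hs])
    obtain ⟨k, ρ, a, hρ, ha, he⟩ := span_add hrel (span_smul hds hsum)
    exact ⟨k, ρ, a, hρ, ha, by rw [← he, smul_sub]; abel⟩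
  -- Step 5: sum over the support
  have hspan : ∀ T : Finset PeriodSymbol, T ⊆ c.support →
      InSpan (∑ s ∈ T, c s • (Finsupp.single s (1 : ℂ) - Ell.loopPart L h₂ h₃ (Ac s) (Bc s) -
        d s • ∑ i : Bs, (q s i : ℂ) • Finsupp.single (logSym (Em i)) (1 : ℂ) -
        e s • Finsupp.single PeriodSymbol.unit (1 : ℂ))) := by
    intro T hT
    induction T using Finset.induction_on with
    | empty => simpa using span_zero
    | insert s T hs ih =>
      rw [Finset.sum_insert hs]
      exact span_add (span_smul (hc s) (hper_s s (hT (Finset.mem_insert_self s T))))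
        (ih (subset_trans (Finset.subset_insert s T) hT))
  obtain ⟨k, ρ, a, hρ, ha, hmain⟩ := hspan c.support subset_rfl
  -- the subtracted element `W = loopPart Atot Btot + Σ_i D_i ℓ(i) + e_tot 𝟙`
  set Atot : Fin 2 → ℂ := ∑ s ∈ c.support, c s • Ac s with hAtot
  set Btot : Fin 2 → ℂ := ∑ s ∈ c.support, c s • Bc s with hBtot
  set D : Bs → ℂ := fun i => ∑ s ∈ c.support, c s * d s * (q s i : ℂ) with hD
  set etot : ℂ := ∑ s ∈ c.support, c s * e s with hetot
  have hc_eq : c = ∑ s ∈ c.support, c s • Finsupp.single s (1 : ℂ) := by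
    conv_lhs => rw [← Finsupp.sum_single c]
    simp only [Finsupp.sum, Finsupp.smul_single_one]
  have hident : ∑ s ∈ c.support, c s • (Finsupp.single s (1 : ℂ) -
        Ell.loopPart L h₂ h₃ (Ac s) (Bc s) -
        d s • ∑ i : Bs, (q s i : ℂ) • Finsupp.single (logSym (Em i)) (1 : ℂ) -
        e s • Finsupp.single PeriodSymbol.unit (1 : ℂ)) =
      c - (Ell.loopPart L h₂ h₃ Atot Btot + ∑ i : Bs, D i • Finsupp.single (logSym (Em i)) (1 : ℂ) +
        etot • Finsupp.single PeriodSymbol.unit (1 : ℂ)) := by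
    have e1 : ∀ s, c s • (Finsupp.single s (1 : ℂ) - Ell.loopPart L h₂ h₃ (Ac s) (Bc s) -
        d s • ∑ i : Bs, (q s i : ℂ) • Finsupp.single (logSym (Em i)) (1 : ℂ) -
        e s • Finsupp.single PeriodSymbol.unit (1 : ℂ)) =
        c s • Finsupp.single s (1 : ℂ) - Ell.loopPart L h₂ h₃ (c s • Ac s) (c s • Bc s) -
          ∑ i : Bs, (c s * d s * (q s i : ℂ)) • Finsupp.single (logSym (Em i)) (1 : ℂ) -
          (c s * e s) • Finsupp.single PeriodSymbol.unit (1 : ℂ) := by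
      intro s
      rw [smul_sub, smul_sub, smul_sub, Ell.smul_loopPart, smul_smul, Finset.smul_sum, smul_smul]
      congr 2
      exact Finset.sum_congr rfl fun i _ => by rw [smul_smul]
    simp_rw [e1]
    rw [Finset.sum_sub_distrib, Finset.sum_sub_distrib, Finset.sum_sub_distrib, ← hc_eq,
      Ell.loopPart_finset_sum, Finset.sum_comm, hD, hetot, Finset.sum_smul]
    simp_rw [Finset.sum_smul]
    abel
  rw [hident] at hmain
  -- Step 6: the period of `W` vanishes
  have hevW : 2 * (Atot 0 * L.ω₁ + Atot 1 * L.ω₂) - 2 * (Btot 0 * L.η₁ + Btot 1 * L.η₂) +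
      (∑ i : Bs, D i * (i : ℂ)) + etot = 0 := by
    have h1 := evalCombination_eq_zero_of_isElementaryRelation ρ a hρ
    rw [← hmain, sub_eq_add_neg, evalCombination_add, h0, zero_add, ← neg_one_smul ℂ,
      evalCombination_smul, evalCombination_add, evalCombination_add, evalCombination_finsetSum,
      evalCombination_smul, evalCombination_single, period_unit,
      Ell.evalCombination_loopPart] at h1
    have h2 : ∀ i : Bs, evalCombination (D i • Finsupp.single (logSym (Em i)) (1 : ℂ)) =
        D i * (i : ℂ) := fun i => by
      rw [evalCombination_smul, evalCombination_single, period_ydx_expPath 0 (i : ℂ) (Em i)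
        (hEm i), sub_zero, one_mul]
    simp_rw [h2] at h1
    rw [neg_one_mul, neg_eq_zero] at h1
    simpa using h1
  -- Step 7: the analytic subgroup theorem at `u = (1; (m_i); (ω₁, η₁), (ω₂, η₂))`
  have hqalg : ∀ s (i : Bs), IsAlgebraic ℚ ((q s i : ℚ) : ℂ) := fun s i => by
    simpa using isAlgebraic_algebraMap (R := ℚ) (A := ℂ) (q s i)
  have hDalg : ∀ i, IsAlgebraic ℚ (D i) := fun i =>
    isAlgebraic_finsetSum _ _ fun s hs => ((hc s).mul (hkey s hs).2.2.2.2.1).mul (hqalg s i)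
  have hetalg : IsAlgebraic ℚ etot :=
    isAlgebraic_finsetSum _ _ fun s hs => (hc s).mul (hkey s hs).2.2.2.2.2.1
  have hAalg : ∀ j, IsAlgebraic ℚ (Atot j) := fun j => by
    rw [hAtot, Finset.sum_apply]
    exact isAlgebraic_finsetSum _ _ fun s hs => (hc s).mul ((hkey s hs).1 j)
  have hBalg : ∀ j, IsAlgebraic ℚ (Btot j) := fun j => by
    rw [hBtot, Finset.sum_apply]
    exact isAlgebraic_finsetSum _ _ fun s hs => (hc s).mul ((hkey s hs).2.1 j)
  set γc : Unit ⊕ (Bs ⊕ (Fin 2 ⊕ Fin 2)) → ℂ :=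
    lieCoords etot D (fun k => 2 * Atot k) (fun k => -2 * Btot k) with hγc
  have hγalg : ∀ x, IsAlgebraic ℚ (γc x) := by
    rintro (_ | i | k | k)
    · exact hetalg
    · exact hDalg i
    · simpa [hγc] using Ell.isAlgebraic_two.mul (hAalg k)
    · simpa [hγc] using Ell.isAlgebraic_two.neg.mul (hBalg k)
  have hγsum : ∑ x, γc x *
      lieCoords 1 (fun i : Bs => (i : ℂ)) ![L.ω₁, L.ω₂] ![L.η₁, L.η₂] x = 0 := by
    simp only [Fintype.sum_sum_type, Finset.univ_unique, Finset.sum_singleton, Fin.sum_univ_two,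
      hγc, lieCoords_inl, lieCoords_inr_inl, lieCoords_inr_inr_inl, lieCoords_inr_inr_inr,
      Matrix.cons_val_zero, Matrix.cons_val_one]
    linear_combination hevW
  have hz : (fun k : Fin 2 => ((![1, 0] : Fin 2 → ℤ) k : ℂ) * L.ω₁ +
      ((![0, 1] : Fin 2 → ℤ) k : ℂ) * L.ω₂) = ![L.ω₁, L.ω₂] := by
    funext k; fin_cases k <;> simp
  have hη : (fun k : Fin 2 => ((![1, 0] : Fin 2 → ℤ) k : ℂ) * L.η₁ +
      ((![0, 1] : Fin 2 → ℤ) k : ℂ) * L.η₂) = ![L.η₁, L.η₂] := by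
    funext k; fin_cases k <;> simp
  have hzero : ∀ x, γc x = 0 := by
    by_contra hne
    push Not at hne
    obtain ⟨x₀, hx₀⟩ := hne
    have hdep : ¬ QbarLinearIndependent
        (lieCoords 1 (fun i : Bs => (i : ℂ)) ![L.ω₁, L.ω₂] ![L.η₁, L.η₂]) :=
      fun hQ => hx₀ (hQ γc hγalg hγsum x₀)
    have hAST' := hAST L h₂ h₃ hCM Bs (Fin 2) 1 (fun i : Bs => (i : ℂ)) ![1, 0] ![0, 1]
      isAlgebraic_one halgB (by rw [hz, hη]; exact hdep)
    rcases hAST' with h0' | ⟨p, hp, hpy⟩ | ⟨a', ha', haz⟩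
    · exact one_ne_zero h0'
    · exact not_int_rel_of_linearIndependent hliB p hp hpy
    · exact L.not_int_rel_periods a' ha' (by simpa [Fin.sum_univ_two] using haz)
  have het0 : etot = 0 := by simpa [hγc] using hzero (Sum.inl ())
  have hD0 : ∀ i, D i = 0 := fun i => by simpa [hγc] using hzero (Sum.inr (Sum.inl i))
  have hA0 : ∀ k, Atot k = 0 := fun k => by
    have h := hzero (Sum.inr (Sum.inr (Sum.inl k)))
    simpa [hγc] using h
  have hB0 : ∀ k, Btot k = 0 := fun k => by
    have h := hzero (Sum.inr (Sum.inr (Sum.inr k)))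
    simpa [hγc] using h
  have hAtot0 : Atot = 0 := funext hA0
  have hBtot0 : Btot = 0 := funext hB0
  -- Step 8: conclude
  refine ⟨k, ρ, a, hρ, ha, ?_⟩
  rw [← hmain, hAtot0, hBtot0, Ell.loopPart_zero]
  simp [hD0, het0]

/-- **… from the general analytic subgroup theorem** for `𝔾ₐ × 𝔾ₘ^ι × (E♮)^κ`
(`analyticSubgroupTheorem_GaGmE`, all algebraic points), through its instance at period vectors
(`analyticSubgroupTheorem_GaGmE.periods`). [cite: HuberWustholz2022, Thm. 13.3 (2) (p. 121), Thm. 6.2] -/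
theorem huberWustholzCurvePeriods_of_ellipticLoops' (hAST : analyticSubgroupTheorem_GaGmE)
    (L : PeriodPair) (h₂ : IsAlgebraic ℚ L.g₂) (h₃ : IsAlgebraic ℚ L.g₃) (hCM : ¬ L.HasCM)
    (c : PeriodSymbol →₀ ℂ) (hc : ∀ s, IsAlgebraic ℚ (c s))
    (hsupp : ∀ s ∈ c.support,
      (s.Z = Ell.curve L ∧ s.γ.toFun 1 = s.γ.toFun 0) ∨
        s.Z = (⟨2, 1, ![X 0 * X 1 - 1]⟩ : CurveData) ∨ s.Z = CurveData.affineLine)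
    (h0 : evalCombination c = 0) :
    ∃ (k : ℕ) (ρ : Fin k → (PeriodSymbol →₀ ℂ)) (a : Fin k → ℂ),
      (∀ l, IsElementaryRelation (ρ l)) ∧ (∀ l, IsAlgebraic ℚ (a l)) ∧ c = ∑ l, a l • ρ l :=
  huberWustholzCurvePeriods_of_ellipticLoops hAST.periods L h₂ h₃ hCM c hc hsupp h0

-- The punctured line `Z_a = {(x, y) | y · ∏ᵢ (x − aᵢ) = 1} ⊂ 𝔸²` (`≅ 𝔸¹ ∖ {a₁, …, a_r}`), as in
-- `CurvePeriodsPuncturedLineProofs.lean`.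
local notation3 (prettyPrint := false) "ZP " a:arg =>
  (⟨2, 1, ![X 1 * ∏ i, (X 0 - C (a i)) - 1]⟩ : CurveData)

/-- **Huber–Wüstholz, Theorem 13.3 (2), for the sub-diagram "genus `0` + closed paths on one non-CM
elliptic curve"** — from the analytic subgroup theorem at period vectors. A vanishing
`ℚ̄`-linear combination of period symbols on the punctured lines `Z_a = {y ∏ᵢ(x − aᵢ) = 1}`
(`a : Fin r → ℚ̄` injective; arbitrary `C¹` paths with algebraic end points), on `𝔾ₘ`, on `𝔸¹`,
and of CLOSED paths on `E_L` (`g₂, g₃ ∈ ℚ̄`, no CM) is a `ℚ̄`-linear combination of the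
elementary relations (R1)–(R5): the punctured-line symbols are transferred to `𝔾ₘ` and `𝟙`
(`exists_transfer_puncturedLine`, (R1)–(R4)), then `huberWustholzCurvePeriods_of_ellipticLoops`.
The periods concerned: `ℚ̄`-combinations of `1`, logarithms of algebraic numbers, `ω₁, ω₂, η₁, η₂`.
[cite: HuberWustholz2022, Thm. 13.3 (2) (p. 121), §13.2 (pp. 122–125), Thm. 15.3 (1)] -/
theorem huberWustholzCurvePeriods_of_puncturedLine_or_ellipticLoops
    (hAST : analyticSubgroupTheorem_GaGmE_periods)
    (L : PeriodPair) (h₂ : IsAlgebraic ℚ L.g₂) (h₃ : IsAlgebraic ℚ L.g₃) (hCM : ¬ L.HasCM)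
    (c : PeriodSymbol →₀ ℂ) (hc : ∀ s, IsAlgebraic ℚ (c s))
    (hsupp : ∀ s ∈ c.support,
      (∃ (r : ℕ) (a : Fin r → ℂ), Function.Injective a ∧ (∀ i, IsAlgebraic ℚ (a i)) ∧
        s.Z = ZP a) ∨
      (s.Z = Ell.curve L ∧ s.γ.toFun 1 = s.γ.toFun 0) ∨
        s.Z = (⟨2, 1, ![X 0 * X 1 - 1]⟩ : CurveData) ∨ s.Z = CurveData.affineLine)
    (h0 : evalCombination c = 0) :
    ∃ (k : ℕ) (ρ : Fin k → (PeriodSymbol →₀ ℂ)) (a : Fin k → ℂ),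
      (∀ l, IsElementaryRelation (ρ l)) ∧ (∀ l, IsAlgebraic ℚ (a l)) ∧ c = ∑ l, a l • ρ l := by
  classical
  have key : ∀ s : PeriodSymbol, ∃ V : PeriodSymbol →₀ ℂ, s ∈ c.support →
      ((∀ t, IsAlgebraic ℚ (V t)) ∧ InSpan (Finsupp.single s 1 - V) ∧
        (∀ t ∈ V.support,
          (t.Z = Ell.curve L ∧ t.γ.toFun 1 = t.γ.toFun 0) ∨
            t.Z = (⟨2, 1, ![X 0 * X 1 - 1]⟩ : CurveData) ∨ t.Z = CurveData.affineLine)) := by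
    intro s
    by_cases hs : s ∈ c.support
    · rcases hsupp s hs with ⟨r, a, hinj, ha, hsZ⟩ | hrest
      · obtain ⟨Z, hZ, ω, hω, γ⟩ := s
        dsimp only at hsZ
        subst hsZ
        obtain rfl : hZ = isSmoothAffineCurve_puncturedLine ha := rfl
        obtain ⟨cf, γ', e, hcf, he, hrel⟩ := exists_transfer_puncturedLine ha hinj ω hω γ
        refine ⟨∑ i, cf i • Finsupp.single (⟨⟨2, 1, ![X 0 * X 1 - 1]⟩,
            isSmoothAffineCurve_mulGroup, ![X 1, 0], hasAlgCoeffs_ydx, γ' i⟩ : PeriodSymbol)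
            (1 : ℂ) + e • Finsupp.single PeriodSymbol.unit (1 : ℂ), fun _ => ⟨?_, ?_, ?_⟩⟩
        · intro t
          rw [Finsupp.add_apply, Finsupp.finsetSum_apply, Finsupp.smul_apply, smul_eq_mul]
          refine (isAlgebraic_finsetSum _ _ fun i _ => ?_).add
            (he.mul (isAlgebraic_single_one_apply _ _))
          rw [Finsupp.smul_apply, smul_eq_mul]
          exact (hcf i).mul (isAlgebraic_single_one_apply _ _)
        · obtain ⟨k, ρ, b, hρ, hb, hsum⟩ := hrel
          exact ⟨k, ρ, b, hρ, hb, by rw [← hsum]; abel⟩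
        · intro t ht
          rcases Finset.mem_union.1 (Finsupp.support_add ht) with h1 | h2
          · obtain ⟨i, _, hi⟩ := Finset.mem_biUnion.1 (Finsupp.support_finsetSum h1)
            have h3 := (Finsupp.mem_support_single _ _ _).1 (Finsupp.support_smul hi)
            exact Or.inr (Or.inl (by rw [h3.1]))
          · have h3 := (Finsupp.mem_support_single _ _ _).1 (Finsupp.support_smul h2)
            exact Or.inr (Or.inr (by rw [h3.1]; rfl))
      · exact ⟨Finsupp.single s 1, fun _ => ⟨fun t => isAlgebraic_single_one_apply _ _,
          by rw [sub_self]; exact span_zero, fun t ht => by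
            have h3 := (Finsupp.mem_support_single _ _ _).1 ht
            rw [h3.1]
            exact hrest⟩⟩
    · exact ⟨0, fun h => (hs h).elim⟩
  choose V hV using key
  exact span_of_transfer_finsupp c hc V (fun s hs => (hV s hs).1) (fun s hs => (hV s hs).2.1)
    (fun t => (t.Z = Ell.curve L ∧ t.γ.toFun 1 = t.γ.toFun 0) ∨
      t.Z = (⟨2, 1, ![X 0 * X 1 - 1]⟩ : CurveData) ∨ t.Z = CurveData.affineLine)
    (fun s hs => (hV s hs).2.2)
    (fun c' hc' hsupp' h0' =>
      huberWustholzCurvePeriods_of_ellipticLoops hAST L h₂ h₃ hCM c' hc' hsupp' h0')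
    h0

end Main

end CurvePeriods

end Literature.NumberTheory.Transcendental

end
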